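import Mathlib
import HarnessLib
import Literature.Computability.AlgebraicComplexity.SymmetricCircuitSubstitution
import Literature.Computability.AlgebraicComplexity.SymmetricCircuitPullback
import Literature.Computability.AlgebraicComplexity.SymmetricCircuitScaledInputs
import Summits.ValiantsHypothesis.ValiantsHypothesis.Theorems.MonotoneRestorationNonnegRestorationQPSmlAffineSize
import Summits.ValiantsHypothesis.ValiantsHypothesis.Theorems.MonotoneRestorationOrbitRestorationQPSmlAffineRowRestoration

/-!
# Square-symmetric circuits of quasi-polynomial SIZE are closed under equivariant renaming of the variables;
# the affine ROW-set-multilinear stratum in SIZE currency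
(route MonotoneRestoration; cruxes `NonnegRestorationQP` stmt-ValiantsHypothesis-16191 and `MonotoneRestorationQP`
stmt-ValiantsHypothesis-15886, whose conclusions bound the SIZE `Fintype.card G` of a square-symmetric circuit; also the orbit
crux `OrbitRestorationQP` stmt-ValiantsHypothesis-18293)

Namespace `Summit.ValiantsHypothesis.ValiantsHypothesis.Theorems.SymmetricRename`.  Definition-free.

`…NonnegRestorationQPSmlAffineSize.lean` put the affine COLUMN-set-multilinear stratum of A_∞ into SIZE currency.  Its row twin
(item (R2) of the repair census SML-AFFINE-LANE-g8) needs the transport of a square-symmetric circuit along the transposition of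
the variable matrix WITHOUT losing control of the number of gates.  In ORBIT currency the tree transposes through value
derivations (`Transpose.qpOrbitRestorable_transpose`, flat cost `+3` in the exponent); in SIZE currency we compose three
Literature constructions on Dawar–Wilsenach labelled circuits — scaled inputs (`exists_scaledInputs`, the identity layer
`x ↦ 1·x` with outputs indexed by the variables), pullback of outputs along an equivariant map (`IsSymmetric.exists_pullback`)
and substitution (`IsSymmetric.exists_substitution`):

* `aeval_X_comp_eq_rename` — `aeval (X ∘ e) = rename e` (folklore);
* `exists_symmetric_rename_size` — **EQUIVARIANT RENAMING IN SIZE CURRENCY**: for any group `Γ` acting on finite variable sets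
  `V`, `V'` and on the outputs `Y`, a `Γ`-symmetric circuit over `V` computing `(p_y)_y` and a `Γ`-equivariant map `e : V → V'`
  yield a `Γ`-symmetric circuit over `V'` computing `(rename e p_y)_y` on at most `|G| + 3|V'|… ` precisely
  `|G| + (2|V'| + 1 + |V|)` gates;
* `exists_symmetric_transpose_size` — the instance `e = Prod.swap` on the `n × n` matrix under the diagonal action of `Sym (Fin n)`
  (cost `3n² + 1` gates);
* `qp_add_poly_le` — `2^((log₂ n + c)^c) + (3n² + 1) ≤ 2^((log₂ n + c')^c')` for one `c' = c'(c)`;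
* `symmetricSize_of_transpose` — **a family has square-symmetric circuits of quasi-polynomial SIZE iff its transpose does**
  (family form, one constant);
* `affineRowSml_symmetricSize` — **every matrix-symmetric family over `ℂ` with affine ROW-set-multilinear `ΣΠΣ` circuits of at
  most `n^c + c` product gates has square-symmetric circuits of SIZE `≤ 2^((log₂ n + c')^c')`**;
* `affineSml_symmetricSize` — both sides in one statement (the side may depend on the level);
* `nonneg_affineRowSml_symmetricSize`, `nonneg_affineSml_symmetricSize` — the same in the exact shape of the conclusion of
  `NonnegRestorationQP` / `MonotoneRestorationQP` (families over `ℝ≥0`, complexified by `map`).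

Honest label: transport of structure plus bookkeeping over landed theorems; a stratum of the size cruxes' CONCLUSIONS on an
explicit circuit class (the `VP` / monotone hypotheses are not used); no registered stub is closed; VP ≠ VNP untouched.
[folklore] [cite: DawarWilsenach2025, Def. 2.2, Def. 3.6, Def. 3.7]
-/

noncomputable section

open scoped Classical

-- `Summit.ValiantsHypothesis.ValiantsHypothesis.…` is the tree's single-conjunct layout (Sub = Summit).
set_option linter.dupNamespace false

namespace Summit.ValiantsHypothesis.ValiantsHypothesis.Theorems.SymmetricRename

open MvPolynomial Finset Literature.Computability.AlgebraicComplexity OrbitRestorationQPDepthThreeRung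
  SmlAffineRestoration SmlRestoration

/-! ### Equivariant renaming of the variables in SIZE currency -/

/-- `aeval (X ∘ e) = rename e`. [folklore] -/
theorem aeval_X_comp_eq_rename {K : Type*} [CommSemiring K] {V V' : Type*} (e : V → V') (p : MvPolynomial V K) :
    aeval (fun v => (X (e v) : MvPolynomial V' K)) p = rename e p := by
  induction p using MvPolynomial.induction_on with
  | C a => simp
  | add p q hp hq => simp only [map_add, hp, hq]
  | mul_X p v hp => simp only [map_mul, hp, aeval_X, rename_X]

/-- **EQUIVARIANT RENAMING IN SIZE CURRENCY.**  A `Γ`-symmetric labelled circuit over the variables `V` computing `(p_y)_{y ∈ Y}`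
and a `Γ`-equivariant map of variables `e : V → V'` give a `Γ`-symmetric labelled circuit over `V'` computing
`(rename e p_y)_{y ∈ Y}` on at most `|G| + (2|V'| + 1 + |V|)` gates: substitute the identity layer over `V'` (scaled inputs with
scale `1`), its outputs re-indexed along `e`, into the given circuit. [cite: DawarWilsenach2025, Def. 3.7] -/
theorem exists_symmetric_rename_size {K : Type} [CommSemiring K] {V V' : Type} [Fintype V] [Fintype V'] [DecidableEq V']
    {Y : Type} {G : Type} [Fintype G] {Γ : Type*} [Group Γ] [MulAction Γ V] [MulAction Γ V'] [MulAction Γ Y]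
    {C : LabelledArithCircuit K V Y G} (hC : C.IsSymmetric Γ)
    (e : V → V') (he : ∀ (γ : Γ) (v : V), e (γ • v) = γ • e v) :
    ∃ (G' : Type) (_ : Fintype G') (C' : LabelledArithCircuit K V' Y G'),
      C'.IsSymmetric Γ ∧ (∀ y, C'.eval (C'.output y) = rename e (C.eval (C.output y))) ∧
      Fintype.card G' ≤ Fintype.card G + (2 * Fintype.card V' + 1 + Fintype.card V) := by
  obtain ⟨G₀, i₀, C₀, hC₀, hev₀, hcard₀⟩ := LabelledArithCircuit.exists_scaledInputs (K := K) (X := V') Γ (1 : K)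
  obtain ⟨G₁, i₁, C₁, hC₁, hev₁, hcard₁⟩ := hC₀.exists_pullback e he
  obtain ⟨G₂, i₂, C₂, hC₂, hev₂, hcard₂⟩ := hC₁.exists_substitution hC
  refine ⟨G₂, i₂, C₂, hC₂, fun y => ?_, ?_⟩
  · rw [hev₂ y]
    have hfun : (fun v => C₁.eval (C₁.output v)) = fun v => (X (e v) : MvPolynomial V' K) := by
      funext v
      rw [hev₁ v, hev₀ (e v), C_1, one_mul]
    rw [hfun, aeval_X_comp_eq_rename]
  · calc Fintype.card G₂ ≤ Fintype.card G₁ + Fintype.card G := hcard₂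
      _ ≤ (Fintype.card G₀ + Fintype.card V) + Fintype.card G := by gcongr
      _ ≤ ((2 * Fintype.card V' + 1) + Fintype.card V) + Fintype.card G := by gcongr
      _ = Fintype.card G + (2 * Fintype.card V' + 1 + Fintype.card V) := by ring

/-- **TRANSPOSITION IN SIZE CURRENCY.**  A square-symmetric circuit (diagonal action of `Sym (Fin n)`) computing `p` on the
`n × n` variable matrix yields one computing the transpose `pᵀ = rename Prod.swap p` with at most `3n² + 1` more gates.
[cite: DawarWilsenach2025, Def. 3.7] -/
theorem exists_symmetric_transpose_size {n : ℕ} {p : MvPolynomial (Fin n × Fin n) ℂ} {B : ℕ}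
    (h : ∃ (G : Type) (_ : Fintype G) (C : LabelledArithCircuit ℂ (Fin n × Fin n) Unit G),
      C.IsSymmetric (Equiv.Perm (Fin n)) ∧ C.eval (C.output ()) = p ∧ Fintype.card G ≤ B) :
    ∃ (G : Type) (_ : Fintype G) (C : LabelledArithCircuit ℂ (Fin n × Fin n) Unit G),
      C.IsSymmetric (Equiv.Perm (Fin n)) ∧
      C.eval (C.output ()) = rename (Prod.swap : Fin n × Fin n → Fin n × Fin n) p ∧
      Fintype.card G ≤ B + (3 * n ^ 2 + 1) := by
  obtain ⟨G, inst, C, hC, hev, hcard⟩ := h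
  have he : ∀ (γ : Equiv.Perm (Fin n)) (v : Fin n × Fin n), Prod.swap (γ • v) = γ • Prod.swap v := fun _ _ => rfl
  obtain ⟨G', inst', C', hC', hev', hcard'⟩ := exists_symmetric_rename_size (Y := Unit) hC Prod.swap he
  refine ⟨G', inst', C', hC', by rw [hev' (), hev], hcard'.trans ?_⟩
  have hV : Fintype.card (Fin n × Fin n) = n ^ 2 := by rw [Fintype.card_prod, Fintype.card_fin, sq]
  rw [hV]
  omega

/-- Arithmetic: a quasi-polynomial bound absorbs `3n² + 1` extra gates. [folklore] -/
theorem qp_add_poly_le (c : ℕ) : ∃ c' : ℕ, ∀ n : ℕ,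
    2 ^ ((Nat.log 2 n + c) ^ c) + (3 * n ^ 2 + 1) ≤ 2 ^ ((Nat.log 2 n + c') ^ c') := by
  obtain ⟨c₃, hc₃⟩ := zeta_poly_mul_qp_le 4 2 c 1
  refine ⟨c₃, fun n => le_trans ?_ (hc₃ n)⟩
  have h1 : 1 ≤ 2 ^ (1 * (Nat.log 2 n + c) ^ c) := Nat.one_le_two_pow
  have hsq : (n + 2) ^ 2 = n ^ 2 + 4 * n + 4 := by ring
  have h2 : 3 * n ^ 2 + 1 ≤ 3 * (n + 2) ^ 2 := by rw [hsq]; omega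
  have h3 : 2 ^ ((Nat.log 2 n + c) ^ c) ≤ (n + 2) ^ 2 * 2 ^ (1 * (Nat.log 2 n + c) ^ c) := by
    rw [one_mul]
    exact Nat.le_mul_of_pos_left _ (by positivity)
  have h4 : 3 * n ^ 2 + 1 ≤ 3 * (n + 2) ^ 2 * 2 ^ (1 * (Nat.log 2 n + c) ^ c) :=
    h2.trans (Nat.le_mul_of_pos_right _ h1)
  calc 2 ^ ((Nat.log 2 n + c) ^ c) + (3 * n ^ 2 + 1)
      ≤ (n + 2) ^ 2 * 2 ^ (1 * (Nat.log 2 n + c) ^ c) + 3 * (n + 2) ^ 2 * 2 ^ (1 * (Nat.log 2 n + c) ^ c) :=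
        Nat.add_le_add h3 h4
    _ = 4 * (n + 2) ^ 2 * 2 ^ (1 * (Nat.log 2 n + c) ^ c) := by ring

/-- **A family has square-symmetric circuits of quasi-polynomial SIZE as soon as its transposed family does** (and conversely, by
the same statement applied to the transposed family, `rename Prod.swap` being an involution). [folklore] -/
theorem symmetricSize_of_transpose (f : (n : ℕ) → MvPolynomial (Fin n × Fin n) ℂ)
    (h : ∃ c : ℕ, ∀ n : ℕ, ∃ (G : Type) (_ : Fintype G) (C : LabelledArithCircuit ℂ (Fin n × Fin n) Unit G),
      C.IsSymmetric (Equiv.Perm (Fin n)) ∧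
      C.eval (C.output ()) = rename (Prod.swap : Fin n × Fin n → Fin n × Fin n) (f n) ∧
      Fintype.card G ≤ 2 ^ ((Nat.log 2 n + c) ^ c)) :
    ∃ c' : ℕ, ∀ n : ℕ, ∃ (G : Type) (_ : Fintype G) (C : LabelledArithCircuit ℂ (Fin n × Fin n) Unit G),
      C.IsSymmetric (Equiv.Perm (Fin n)) ∧ C.eval (C.output ()) = f n ∧
      Fintype.card G ≤ 2 ^ ((Nat.log 2 n + c') ^ c') := by
  obtain ⟨c, hc⟩ := h
  obtain ⟨c', hc'⟩ := qp_add_poly_le c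
  refine ⟨c', fun n => ?_⟩
  obtain ⟨G, inst, C, hC, hev, hcard⟩ := exists_symmetric_transpose_size (hc n)
  refine ⟨G, inst, C, hC, ?_, hcard.trans (hc' n)⟩
  rw [hev, rename_rename]
  have hid : (Prod.swap ∘ Prod.swap : Fin n × Fin n → Fin n × Fin n) = id := funext fun x => Prod.swap_swap x
  rw [hid, rename_id]
  rfl

/-! ### The affine ROW-set-multilinear stratum in SIZE currency -/

/-- **THE AFFINE ROW-SET-MULTILINEAR STRATUM IN SIZE CURRENCY.**  A matrix-symmetric family with affine row-set-multilinear
`ΣΠΣ` circuits `f n = Σ_{t<s} Π_a (β_{t,a} + Σ_b α_{t,a,b} x_{(a,b)})` of at most `n^c + c` product gates has square-symmetric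
circuits of SIZE `≤ 2^((log₂ n + c')^c')` (transpose of `affineColSml_symmetricSize`). [folklore] -/
theorem affineRowSml_symmetricSize :
    ∀ f : (n : ℕ) → MvPolynomial (Fin n × Fin n) ℂ, IsMatrixSymmetric f →
      (∃ c : ℕ, ∀ n : ℕ, ∃ (s : ℕ) (β : Fin s → Fin n → ℂ) (α : Fin s → Fin n → Fin n → ℂ), s ≤ n ^ c + c ∧
        f n = ∑ t : Fin s, ∏ a : Fin n, (C (β t a) + ∑ b : Fin n, C (α t a b) * X (a, b))) →
      ∃ c' : ℕ, ∀ n : ℕ, ∃ (G : Type) (_ : Fintype G) (C : LabelledArithCircuit ℂ (Fin n × Fin n) Unit G),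
        C.IsSymmetric (Equiv.Perm (Fin n)) ∧ C.eval (C.output ()) = f n ∧
        Fintype.card G ≤ 2 ^ ((Nat.log 2 n + c') ^ c') := by
  intro f hsym ⟨c, hcirc⟩
  have hT : ∃ c₁ : ℕ, ∀ n : ℕ, ∃ (s : ℕ) (β : Fin s → Fin n → ℂ) (α : Fin s → Fin n → Fin n → ℂ), s ≤ n ^ c₁ + c₁ ∧
      rename (Prod.swap : Fin n × Fin n → Fin n × Fin n) (f n) =
        ∑ t : Fin s, ∏ b : Fin n, (C (β t b) + ∑ a : Fin n, C (α t b a) * X (a, b)) := by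
    refine ⟨c, fun n => ?_⟩
    obtain ⟨s, β, α, hs, hf⟩ := hcirc n
    exact ⟨s, β, α, hs, by rw [hf, rename_swap_affineRowSml]⟩
  exact symmetricSize_of_transpose f (affineColSml_symmetricSize _ (isMatrixSymmetric_transpose hsym) hT)

/-- **THE AFFINE SET-MULTILINEAR STRATUM IN SIZE CURRENCY, BOTH SIDES.**  A matrix-symmetric family each of whose members has
an affine column- OR row-set-multilinear `ΣΠΣ` circuit with at most `n^c + c` product gates (the side may depend on the level)
has square-symmetric circuits of quasi-polynomial SIZE. [folklore] -/
theorem affineSml_symmetricSize :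
    ∀ f : (n : ℕ) → MvPolynomial (Fin n × Fin n) ℂ, IsMatrixSymmetric f →
      (∃ c : ℕ, ∀ n : ℕ, ∃ (s : ℕ) (β : Fin s → Fin n → ℂ) (α : Fin s → Fin n → Fin n → ℂ), s ≤ n ^ c + c ∧
        (f n = ∑ t : Fin s, ∏ b : Fin n, (C (β t b) + ∑ a : Fin n, C (α t b a) * X (a, b)) ∨
         f n = ∑ t : Fin s, ∏ a : Fin n, (C (β t a) + ∑ b : Fin n, C (α t a b) * X (a, b)))) →
      ∃ c' : ℕ, ∀ n : ℕ, ∃ (G : Type) (_ : Fintype G) (C : LabelledArithCircuit ℂ (Fin n × Fin n) Unit G),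
        C.IsSymmetric (Equiv.Perm (Fin n)) ∧ C.eval (C.output ()) = f n ∧
        Fintype.card G ≤ 2 ^ ((Nat.log 2 n + c') ^ c') := by
  intro f hsym ⟨c, hcirc⟩
  -- the column-sml levels and the row-sml levels, as two matrix-symmetric families (zero elsewhere)
  let P : ℕ → Prop := fun n => ∃ (s : ℕ) (β : Fin s → Fin n → ℂ) (α : Fin s → Fin n → Fin n → ℂ), s ≤ n ^ c + c ∧
    f n = ∑ t : Fin s, ∏ b : Fin n, (C (β t b) + ∑ a : Fin n, C (α t b a) * X (a, b))
  have hcol : ∀ n, ∃ (s : ℕ) (β : Fin s → Fin n → ℂ) (α : Fin s → Fin n → Fin n → ℂ), s ≤ n ^ c + c ∧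
      (if P n then f n else 0) = ∑ t : Fin s, ∏ b : Fin n, (C (β t b) + ∑ a : Fin n, C (α t b a) * X (a, b)) := by
    intro n
    by_cases h : P n
    · obtain ⟨s, β, α, hs, hf⟩ := h
      exact ⟨s, β, α, hs, by rw [if_pos (show P n from ⟨s, β, α, hs, hf⟩), hf]⟩
    · refine ⟨0, fun _ _ => 0, fun _ _ _ => 0, Nat.zero_le _, ?_⟩
      rw [if_neg h]; simp
  have hrow : ∀ n, ∃ (s : ℕ) (β : Fin s → Fin n → ℂ) (α : Fin s → Fin n → Fin n → ℂ), s ≤ n ^ c + c ∧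
      (if P n then (0 : MvPolynomial (Fin n × Fin n) ℂ) else f n) =
        ∑ t : Fin s, ∏ a : Fin n, (C (β t a) + ∑ b : Fin n, C (α t a b) * X (a, b)) := by
    intro n
    by_cases h : P n
    · refine ⟨0, fun _ _ => 0, fun _ _ _ => 0, Nat.zero_le _, ?_⟩
      rw [if_pos h]; simp
    · obtain ⟨s, β, α, hs, hf⟩ := hcirc n
      rcases hf with hf | hf
      · exact absurd ⟨s, β, α, hs, hf⟩ h
      · exact ⟨s, β, α, hs, by rw [if_neg h, hf]⟩
  have hsymIf : IsMatrixSymmetric fun n => if P n then f n else 0 := by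
    intro n σ τ
    by_cases h : P n
    · simp only [if_pos h]; exact hsym n σ τ
    · simp only [if_neg h, map_zero]
  have hsymIf' : IsMatrixSymmetric fun n => if P n then (0 : MvPolynomial (Fin n × Fin n) ℂ) else f n := by
    intro n σ τ
    by_cases h : P n
    · simp only [if_pos h, map_zero]
    · simp only [if_neg h]; exact hsym n σ τ
  obtain ⟨c₁, hc₁⟩ := affineColSml_symmetricSize _ hsymIf ⟨c, hcol⟩
  obtain ⟨c₂, hc₂⟩ := affineRowSml_symmetricSize _ hsymIf' ⟨c, hrow⟩
  refine ⟨max c₁ c₂, fun n => ?_⟩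
  by_cases h : P n
  · obtain ⟨G, inst, C, hC, hev, hcard⟩ := hc₁ n
    simp only [if_pos h] at hev
    exact ⟨G, inst, C, hC, hev, hcard.trans (Restorable.bound_mono (le_max_left _ _) _)⟩
  · obtain ⟨G, inst, C, hC, hev, hcard⟩ := hc₂ n
    simp only [if_neg h] at hev
    exact ⟨G, inst, C, hC, hev, hcard.trans (Restorable.bound_mono (le_max_right _ _) _)⟩

/-! ### In the exact shape of the conclusions of `NonnegRestorationQP` / `MonotoneRestorationQP` -/

/-- **The row stratum in the exact shape of the conclusion of `NonnegRestorationQP` / `MonotoneRestorationQP`.**  For a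
matrix-symmetric family `h n ∈ ℝ≥0[x_ij]` whose complexification `map (h n)` has affine ROW-set-multilinear `ΣΠΣ` circuits of at
most `n^c + c` product gates, there are square-symmetric circuits over `ℂ` computing `map (h n)` of SIZE `≤ 2^((log₂ n + c')^c')`.
[folklore] -/
theorem nonneg_affineRowSml_symmetricSize (h : (n : ℕ) → MvPolynomial (Fin n × Fin n) NNReal)
    (hsym : ∀ (n : ℕ) (σ τ : Equiv.Perm (Fin n)),
      MvPolynomial.rename (fun p : Fin n × Fin n => (σ p.1, τ p.2)) (h n) = h n)
    (hcirc : ∃ c : ℕ, ∀ n : ℕ, ∃ (s : ℕ) (β : Fin s → Fin n → ℂ) (α : Fin s → Fin n → Fin n → ℂ), s ≤ n ^ c + c ∧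
      MvPolynomial.map (Complex.ofRealHom.comp NNReal.toRealHom) (h n) =
        ∑ t : Fin s, ∏ a : Fin n, (C (β t a) + ∑ b : Fin n, C (α t a b) * X (a, b))) :
    ∃ c : ℕ, ∀ n : ℕ, ∃ (G : Type) (_ : Fintype G) (C : LabelledArithCircuit ℂ (Fin n × Fin n) Unit G),
      C.IsSymmetric (Equiv.Perm (Fin n)) ∧
      C.eval (C.output ()) = MvPolynomial.map (Complex.ofRealHom.comp NNReal.toRealHom) (h n) ∧
      Fintype.card G ≤ 2 ^ ((Nat.log 2 n + c) ^ c) := by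
  have hsymC : IsMatrixSymmetric fun n => MvPolynomial.map (Complex.ofRealHom.comp NNReal.toRealHom) (h n) := by
    intro n σ τ
    simp only [← map_rename, hsym n σ τ]
  exact affineRowSml_symmetricSize _ hsymC hcirc

/-- **Both sides, in the exact shape of the conclusion of `NonnegRestorationQP` / `MonotoneRestorationQP`.** [folklore] -/
theorem nonneg_affineSml_symmetricSize (h : (n : ℕ) → MvPolynomial (Fin n × Fin n) NNReal)
    (hsym : ∀ (n : ℕ) (σ τ : Equiv.Perm (Fin n)),
      MvPolynomial.rename (fun p : Fin n × Fin n => (σ p.1, τ p.2)) (h n) = h n)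
    (hcirc : ∃ c : ℕ, ∀ n : ℕ, ∃ (s : ℕ) (β : Fin s → Fin n → ℂ) (α : Fin s → Fin n → Fin n → ℂ), s ≤ n ^ c + c ∧
      (MvPolynomial.map (Complex.ofRealHom.comp NNReal.toRealHom) (h n) =
          ∑ t : Fin s, ∏ b : Fin n, (C (β t b) + ∑ a : Fin n, C (α t b a) * X (a, b)) ∨
       MvPolynomial.map (Complex.ofRealHom.comp NNReal.toRealHom) (h n) =
          ∑ t : Fin s, ∏ a : Fin n, (C (β t a) + ∑ b : Fin n, C (α t a b) * X (a, b)))) :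
    ∃ c : ℕ, ∀ n : ℕ, ∃ (G : Type) (_ : Fintype G) (C : LabelledArithCircuit ℂ (Fin n × Fin n) Unit G),
      C.IsSymmetric (Equiv.Perm (Fin n)) ∧
      C.eval (C.output ()) = MvPolynomial.map (Complex.ofRealHom.comp NNReal.toRealHom) (h n) ∧
      Fintype.card G ≤ 2 ^ ((Nat.log 2 n + c) ^ c) := by
  have hsymC : IsMatrixSymmetric fun n => MvPolynomial.map (Complex.ofRealHom.comp NNReal.toRealHom) (h n) := by
    intro n σ τ
    simp only [← map_rename, hsym n σ τ]
  exact affineSml_symmetricSize _ hsymC hcirc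

end Summit.ValiantsHypothesis.ValiantsHypothesis.Theorems.SymmetricRename

end
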